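import Literature.Computability.Complexity.CHPrimeCounting
import Literature.Computability.Complexity.CHModArith
import HarnessLib

/-!
# The Chinese-remainder digits of the halved numbers `Y_s` inside the counting hierarchy

Toolkit file (theorems only) of the scaled-up `FOM + MAJ` calculus, part of the conversion from
Chinese remainder representation to binary (Hesse–Allender–Barrington, JCSS 65 (2002), §4; Bürgisser,
ECCC TR06-113, Thm. 3.4). For a number `X = X(w)` given by its residues `ρ ⟨w, q⟩ = X mod q`, the
auxiliary numbers of HAB's Thm. 4.1 are `Y_s = (2X+1) · 2^{N-1-s} · P⁺` with `P⁺ = ∏_b (A_b+1)/2`, and the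
CRT digits of Lemma 4.3 are `u_q = (Y_s mod q) · h_q mod q`, `h_q = ((2B/q) mod q)⁻¹ = ((2C_q) mod q)^{q-2}`.
Given `CH`-graph residue functions `ρ` (of `X`), `Pp` (of `P⁺`) and `C` (of the cofactors `∏_{q'≠q} q'`),
the digit function

  `U ⟨⟨w, s⟩, q⟩ = ((2ρ + 1) · Pp · (2^{N-1-s} mod q) mod q) · (((2C) mod q)^{q-2} mod q) mod q`

(`N = 2^{t(|w|)+1}`) has a `CH` graph (`digitGraph_mem_CH`): one polynomial-time relation into
which the three `CH`-definable values are substituted (`CHFunctions.rel_apply_mem_CH`). Also its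
bit-size (`digit_lt_two_pow`, `digit_lt_modulus`) and its arithmetic meaning (`digit_eq`).
No new definitions.

## References

* W. Hesse, E. Allender, D. A. M. Barrington, JCSS 65 (2002), §4, Lemma 4.3 and Thm. 4.1.
* P. Bürgisser, ECCC TR06-113 (2006), Thm. 3.4.
-/

namespace Literature.Computability.Complexity

open _root_.Computability Polynomial PRelSigma TTClosure Brick PPSharpP ThresholdPP Plumb Finset

section Digits

variable (t : Polynomial ℕ) {ρ Pp C : List Bool → ℕ} {pρ : Polynomial ℕ}

/-! ### The digit relation is polynomial-time -/

/-- The polynomial-time function computing the digit numeral on words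
`ω = ⟨bin a, ⟨bin b, ⟨bin c, ⟨r, ν⟩⟩⟩⟩`, `r = ⟨⟨w, s⟩, x⟩`:
`((2a+1) · b · pm(2, N-1-s, q) mod q) · pm((2c) mod q, q-2, q) mod q`, `q = val x`, `N = 2^{t|w|+1}`. [folklore] -/
theorem digitFn_mem_FP :
    remFn ∘ pairFn (prodFn ∘ pairFn
        (remFn ∘ pairFn (prodFn ∘ pairFn (prodFn ∘ pairFn (addFn ∘ pairFn (prodFn ∘ pairFn (fun _ => encodeNat 2) fstP) (fun _ => encodeNat 1))
            (fstP ∘ sndP))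
          (modExpFn ∘ pairFn (fun _ => encodeNat 2) (pairFn
            (subFn ∘ pairFn (subFn ∘ pairFn ((fun w => Kannan.zerosFn (polyFn (t + 1) w) ++ [true]) ∘ fstP ∘ fstP ∘ fstP ∘ sndP ∘ sndP ∘ sndP)
              (fun _ => encodeNat 1)) (sndP ∘ fstP ∘ fstP ∘ sndP ∘ sndP ∘ sndP)) (sndP ∘ fstP ∘ sndP ∘ sndP ∘ sndP))))
          (sndP ∘ fstP ∘ sndP ∘ sndP ∘ sndP))
        (modExpFn ∘ pairFn (remFn ∘ pairFn (prodFn ∘ pairFn (fun _ => encodeNat 2) (fstP ∘ sndP ∘ sndP)) (sndP ∘ fstP ∘ sndP ∘ sndP ∘ sndP))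
          (pairFn (subFn ∘ pairFn (sndP ∘ fstP ∘ sndP ∘ sndP ∘ sndP) (fun _ => encodeNat 2)) (sndP ∘ fstP ∘ sndP ∘ sndP ∘ sndP))))
      (sndP ∘ fstP ∘ sndP ∘ sndP ∘ sndP) ∈ FP := by
  have hQ : sndP ∘ fstP ∘ sndP ∘ sndP ∘ sndP ∈ FP :=
    comp_mem_FP sndP_mem_FP (comp_mem_FP fstP_mem_FP (comp_mem_FP sndP_mem_FP (comp_mem_FP sndP_mem_FP sndP_mem_FP)))
  have hW : fstP ∘ fstP ∘ fstP ∘ sndP ∘ sndP ∘ sndP ∈ FP :=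
    comp_mem_FP fstP_mem_FP (comp_mem_FP fstP_mem_FP (comp_mem_FP fstP_mem_FP (comp_mem_FP sndP_mem_FP (comp_mem_FP sndP_mem_FP sndP_mem_FP))))
  have hS : sndP ∘ fstP ∘ fstP ∘ sndP ∘ sndP ∘ sndP ∈ FP :=
    comp_mem_FP sndP_mem_FP (comp_mem_FP fstP_mem_FP (comp_mem_FP fstP_mem_FP (comp_mem_FP sndP_mem_FP (comp_mem_FP sndP_mem_FP sndP_mem_FP))))
  have hE : modExpFn ∘ pairFn (fun _ => encodeNat 2) (pairFn
      (subFn ∘ pairFn (subFn ∘ pairFn ((fun w => Kannan.zerosFn (polyFn (t + 1) w) ++ [true]) ∘ fstP ∘ fstP ∘ fstP ∘ sndP ∘ sndP ∘ sndP)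
        (fun _ => encodeNat 1)) (sndP ∘ fstP ∘ fstP ∘ sndP ∘ sndP ∘ sndP)) (sndP ∘ fstP ∘ sndP ∘ sndP ∘ sndP)) ∈ FP :=
    comp_mem_FP modExpFn_mem_FP (pairFn_mem_FP (const_mem_FP _) (pairFn_mem_FP
      (comp_mem_FP subFn_mem_FP (pairFn_mem_FP (comp_mem_FP subFn_mem_FP (pairFn_mem_FP
        (comp_mem_FP (pow2LenFn_mem_FP (t + 1)) hW) (const_mem_FP _))) hS)) hQ))
  have hY := comp_mem_FP remFn_mem_FP (pairFn_mem_FP (comp_mem_FP prodFn_mem_FP (pairFn_mem_FP (comp_mem_FP prodFn_mem_FP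
    (pairFn_mem_FP (comp_mem_FP addFn_mem_FP (pairFn_mem_FP (comp_mem_FP prodFn_mem_FP (pairFn_mem_FP (const_mem_FP (encodeNat 2)) fstP_mem_FP))
      (const_mem_FP (encodeNat 1)))) (comp_mem_FP fstP_mem_FP sndP_mem_FP))) hE)) hQ)
  have hH := comp_mem_FP modExpFn_mem_FP (pairFn_mem_FP (comp_mem_FP remFn_mem_FP (pairFn_mem_FP (comp_mem_FP prodFn_mem_FP
    (pairFn_mem_FP (const_mem_FP (encodeNat 2)) (comp_mem_FP fstP_mem_FP (comp_mem_FP sndP_mem_FP sndP_mem_FP)))) hQ))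
    (pairFn_mem_FP (comp_mem_FP subFn_mem_FP (pairFn_mem_FP hQ (const_mem_FP (encodeNat 2)))) hQ))
  exact comp_mem_FP remFn_mem_FP (pairFn_mem_FP (comp_mem_FP prodFn_mem_FP (pairFn_mem_FP hY hH)) hQ)

/-- **Value of the digit function** on an arbitrary word `ω` (read as `⟨A, ⟨B, ⟨C, ⟨r, ν⟩⟩⟩⟩` through
the total projections, `a = val A`, `b = val B`, `c = val C`, `r = ⟨⟨w, s⟩, x⟩`, `q = val x`). [folklore] -/
theorem bitsToNat_digitFn (ω : List Bool) :
    bitsToNat ((remFn ∘ pairFn (prodFn ∘ pairFn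
        (remFn ∘ pairFn (prodFn ∘ pairFn (prodFn ∘ pairFn (addFn ∘ pairFn (prodFn ∘ pairFn (fun _ => encodeNat 2) fstP) (fun _ => encodeNat 1))
            (fstP ∘ sndP))
          (modExpFn ∘ pairFn (fun _ => encodeNat 2) (pairFn
            (subFn ∘ pairFn (subFn ∘ pairFn ((fun w => Kannan.zerosFn (polyFn (t + 1) w) ++ [true]) ∘ fstP ∘ fstP ∘ fstP ∘ sndP ∘ sndP ∘ sndP)
              (fun _ => encodeNat 1)) (sndP ∘ fstP ∘ fstP ∘ sndP ∘ sndP ∘ sndP)) (sndP ∘ fstP ∘ sndP ∘ sndP ∘ sndP))))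
          (sndP ∘ fstP ∘ sndP ∘ sndP ∘ sndP))
        (modExpFn ∘ pairFn (remFn ∘ pairFn (prodFn ∘ pairFn (fun _ => encodeNat 2) (fstP ∘ sndP ∘ sndP)) (sndP ∘ fstP ∘ sndP ∘ sndP ∘ sndP))
          (pairFn (subFn ∘ pairFn (sndP ∘ fstP ∘ sndP ∘ sndP ∘ sndP) (fun _ => encodeNat 2)) (sndP ∘ fstP ∘ sndP ∘ sndP ∘ sndP))))
      (sndP ∘ fstP ∘ sndP ∘ sndP ∘ sndP)) ω) =
      ((2 * bitsToNat (fstP ω) + 1) * bitsToNat (fstP (sndP ω)) *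
          (if bitsToNat (sndP (fstP (sndP (sndP (sndP ω))))) ≤ 1 then 0
            else 2 ^ (2 ^ (t.eval (fstP (fstP (fstP (sndP (sndP (sndP ω)))))).length + 1) - 1 - bitsToNat (sndP (fstP (fstP (sndP (sndP (sndP ω))))))) %
              bitsToNat (sndP (fstP (sndP (sndP (sndP ω)))))) % bitsToNat (sndP (fstP (sndP (sndP (sndP ω)))))) *
        (if bitsToNat (sndP (fstP (sndP (sndP (sndP ω))))) ≤ 1 then 0
          else (2 * bitsToNat (fstP (sndP (sndP ω))) % bitsToNat (sndP (fstP (sndP (sndP (sndP ω)))))) ^ (bitsToNat (sndP (fstP (sndP (sndP (sndP ω))))) - 2) %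
            bitsToNat (sndP (fstP (sndP (sndP (sndP ω)))))) %
        bitsToNat (sndP (fstP (sndP (sndP (sndP ω))))) := by
  simp only [Function.comp_apply, pairFn_apply, remFn_boolPair, prodFn_boolPair, addFn_boolPair,
    subFn_boolPair, bitsToNat_encodeNat, bitsToNat_modExpFn, bitsToNat_pow2LenFn, eval_add, eval_one, fstP_boolPair, sndP_boolPair]

/-- **The digits have a `CH` graph** (HAB 2002, Lemma 4.3, the digits `xᵢhᵢ mod mᵢ` of the numbers
`Y_s` of Thm. 4.1, scaled up to `CH` as in Bürgisser 2006, Thm. 3.4): if the residue functions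
`ρ ⟨w, x⟩` (of `X`), `Pp ⟨⟨w, x⟩, x⟩` (of `P⁺`) and `C ⟨⟨w, x⟩, x⟩` (of the cofactors) have `CH` graphs and
polynomial bit-size, then so has, on records `r = ⟨⟨w, s⟩, x⟩` (`q = val x`, `N = 2^{t|w|+1}`),
`U r = ((2ρ+1) · Pp · (2^{N-1-val s} mod q) mod q) · (((2C) mod q)^{q-2} mod q) mod q`. [cite: HesseAllenderBarrington2002, Lemma 4.3] -/
theorem digitGraph_mem_CH (hρ : {z | ρ (fstP z) = bitsToNat (sndP z)} ∈ CH) (hρb : ∀ w, ρ w < 2 ^ pρ.eval w.length)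
    (hPp : {z | Pp (fstP z) = bitsToNat (sndP z)} ∈ CH) (hPpb : ∀ u, Pp u < 2 ^ (X : Polynomial ℕ).eval u.length)
    (hC : {z | C (fstP z) = bitsToNat (sndP z)} ∈ CH) (hCb : ∀ u, C u < 2 ^ (X : Polynomial ℕ).eval u.length) :
    {z | (fun r => ((2 * ρ (boolPair (fstP (fstP r)) (sndP r)) + 1) * Pp (boolPair (boolPair (fstP (fstP r)) (sndP r)) (sndP r)) *
            (if bitsToNat (sndP r) ≤ 1 then 0
              else 2 ^ (2 ^ (t.eval (fstP (fstP r)).length + 1) - 1 - bitsToNat (sndP (fstP r))) % bitsToNat (sndP r)) % bitsToNat (sndP r)) *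
          (if bitsToNat (sndP r) ≤ 1 then 0
            else (2 * C (boolPair (boolPair (fstP (fstP r)) (sndP r)) (sndP r)) % bitsToNat (sndP r)) ^ (bitsToNat (sndP r) - 2) % bitsToNat (sndP r)) %
          bitsToNat (sndP r)) (fstP z) = bitsToNat (sndP z)} ∈ CH := by
  -- the digit as a function of the three substituted values and the record `r`
  set DIG : ℕ → ℕ → ℕ → List Bool → ℕ := fun a b c r =>
    ((2 * a + 1) * b *
        (if bitsToNat (sndP r) ≤ 1 then 0
          else 2 ^ (2 ^ (t.eval (fstP (fstP r)).length + 1) - 1 - bitsToNat (sndP (fstP r))) % bitsToNat (sndP r)) % bitsToNat (sndP r)) *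
      (if bitsToNat (sndP r) ≤ 1 then 0 else (2 * c % bitsToNat (sndP r)) ^ (bitsToNat (sndP r) - 2) % bitsToNat (sndP r)) %
      bitsToNat (sndP r) with hDIG
  -- the digit relation `R_A = {ω | DIG (val A) (val B) (val C) r = val ν}` is in `P`
  have hRA := P_subset_CH (preimage_mem_P eqVal_mem_P (pairFn_mem_FP (digitFn_mem_FP t)
    (comp_mem_FP sndP_mem_FP (comp_mem_FP sndP_mem_FP (comp_mem_FP sndP_mem_FP sndP_mem_FP)))))
  have hRA' : ({ω | DIG (bitsToNat (fstP ω)) (bitsToNat (fstP (sndP ω))) (bitsToNat (fstP (sndP (sndP ω)))) (fstP (sndP (sndP (sndP ω)))) =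
      bitsToNat (sndP (sndP (sndP (sndP ω))))} : Language Bool) ∈ CH :=
    mem_CH_of_iff hRA _ fun ω => by
      change _ ↔ bitsToNat (fstP (pairFn _ (sndP ∘ sndP ∘ sndP ∘ sndP) ω)) = bitsToNat (sndP (pairFn _ (sndP ∘ sndP ∘ sndP ∘ sndP) ω))
      rw [pairFn_apply, fstP_boolPair, sndP_boolPair, bitsToNat_digitFn]
      rfl
  -- substitute `a := ρ ⟨w, x⟩` (read off `w₁ = ⟨B, ⟨C, ⟨r, ν⟩⟩⟩`)
  have hg₁ : pairFn (fstP ∘ fstP ∘ fstP ∘ sndP ∘ sndP) (sndP ∘ fstP ∘ sndP ∘ sndP) ∈ FP :=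
    pairFn_mem_FP (comp_mem_FP fstP_mem_FP (comp_mem_FP fstP_mem_FP (comp_mem_FP fstP_mem_FP (comp_mem_FP sndP_mem_FP sndP_mem_FP))))
      (comp_mem_FP sndP_mem_FP (comp_mem_FP fstP_mem_FP (comp_mem_FP sndP_mem_FP sndP_mem_FP)))
  have hR₁ : ({w₁ | DIG (ρ (boolPair (fstP (fstP (fstP (sndP (sndP w₁))))) (sndP (fstP (sndP (sndP w₁))))))
      (bitsToNat (fstP w₁)) (bitsToNat (fstP (sndP w₁))) (fstP (sndP (sndP w₁))) = bitsToNat (sndP (sndP (sndP w₁)))} : Language Bool) ∈ CH :=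
    mem_CH_of_iff (rel_apply_mem_CH hRA' hρ hρb hg₁) _ fun w₁ => by
      change _ ↔ DIG (bitsToNat (fstP (boolPair (encodeNat (ρ (pairFn (fstP ∘ fstP ∘ fstP ∘ sndP ∘ sndP) (sndP ∘ fstP ∘ sndP ∘ sndP) w₁))) w₁))) _ _ _ = _
      simp only [pairFn_apply, Function.comp_apply, fstP_boolPair, sndP_boolPair, bitsToNat_encodeNat]
      exact Iff.rfl
  -- substitute `b := Pp ⟨⟨w, x⟩, x⟩` (read off `w₂ = ⟨C, ⟨r, ν⟩⟩`)
  have hg₂ : pairFn (pairFn (fstP ∘ fstP ∘ fstP ∘ sndP) (sndP ∘ fstP ∘ sndP)) (sndP ∘ fstP ∘ sndP) ∈ FP :=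
    pairFn_mem_FP (pairFn_mem_FP (comp_mem_FP fstP_mem_FP (comp_mem_FP fstP_mem_FP (comp_mem_FP fstP_mem_FP sndP_mem_FP)))
      (comp_mem_FP sndP_mem_FP (comp_mem_FP fstP_mem_FP sndP_mem_FP))) (comp_mem_FP sndP_mem_FP (comp_mem_FP fstP_mem_FP sndP_mem_FP))
  obtain ⟨s₂, hs₂⟩ := exists_poly_length_le_of_mem_FP hg₂
  have hR₂ : ({w₂ | DIG (ρ (boolPair (fstP (fstP (fstP (sndP w₂)))) (sndP (fstP (sndP w₂)))))
      (Pp (boolPair (boolPair (fstP (fstP (fstP (sndP w₂)))) (sndP (fstP (sndP w₂)))) (sndP (fstP (sndP w₂)))))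
      (bitsToNat (fstP w₂)) (fstP (sndP w₂)) = bitsToNat (sndP (sndP w₂))} : Language Bool) ∈ CH :=
    mem_CH_of_iff (rel_apply_mem_CH hR₁ (graph_comp_FP_mem_CH hPp hg₂) (bound_comp_FP hPpb hs₂) OracleCompose.id_mem_FP) _ fun w₂ => by
      change _ ↔ DIG (ρ (boolPair (fstP (fstP (fstP (sndP (sndP (boolPair (encodeNat (Pp (pairFn (pairFn (fstP ∘ fstP ∘ fstP ∘ sndP) (sndP ∘ fstP ∘ sndP))
        (sndP ∘ fstP ∘ sndP) (id w₂)))) w₂)))))) _)) _ _ _ = _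
      simp only [pairFn_apply, Function.comp_apply, fstP_boolPair, sndP_boolPair, bitsToNat_encodeNat, id]
      exact Iff.rfl
  -- substitute `c := C ⟨⟨w, x⟩, x⟩` (read off `z = ⟨r, ν⟩`)
  have hg₃ : pairFn (pairFn (fstP ∘ fstP ∘ fstP) (sndP ∘ fstP)) (sndP ∘ fstP) ∈ FP :=
    pairFn_mem_FP (pairFn_mem_FP (comp_mem_FP fstP_mem_FP (comp_mem_FP fstP_mem_FP fstP_mem_FP)) (comp_mem_FP sndP_mem_FP fstP_mem_FP))
      (comp_mem_FP sndP_mem_FP fstP_mem_FP)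
  obtain ⟨s₃, hs₃⟩ := exists_poly_length_le_of_mem_FP hg₃
  refine mem_CH_of_iff (rel_apply_mem_CH hR₂ (graph_comp_FP_mem_CH hC hg₃) (bound_comp_FP hCb hs₃) OracleCompose.id_mem_FP) _ fun z => ?_
  change _ ↔ DIG (ρ (boolPair (fstP (fstP (fstP (sndP (boolPair (encodeNat (C (pairFn (pairFn (fstP ∘ fstP ∘ fstP) (sndP ∘ fstP)) (sndP ∘ fstP) (id z))))
    z))))) _)) _ _ _ = _
  simp only [pairFn_apply, Function.comp_apply, fstP_boolPair, sndP_boolPair, bitsToNat_encodeNat, id]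
  exact Iff.rfl

/-- **The digit is below the modulus** (for `q ≥ 1`; for `q = 0` it is `0`), hence `< 2^{|r|}`. [folklore] -/
theorem digit_lt_two_pow (ρ Pp C : List Bool → ℕ) (r : List Bool) :
    ((2 * ρ (boolPair (fstP (fstP r)) (sndP r)) + 1) * Pp (boolPair (boolPair (fstP (fstP r)) (sndP r)) (sndP r)) *
            (if bitsToNat (sndP r) ≤ 1 then 0
              else 2 ^ (2 ^ (t.eval (fstP (fstP r)).length + 1) - 1 - bitsToNat (sndP (fstP r))) % bitsToNat (sndP r)) % bitsToNat (sndP r)) *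
          (if bitsToNat (sndP r) ≤ 1 then 0
            else (2 * C (boolPair (boolPair (fstP (fstP r)) (sndP r)) (sndP r)) % bitsToNat (sndP r)) ^ (bitsToNat (sndP r) - 2) % bitsToNat (sndP r)) %
          bitsToNat (sndP r) < 2 ^ (X : Polynomial ℕ).eval r.length := by
  have hq : bitsToNat (sndP r) < 2 ^ (X : Polynomial ℕ).eval r.length := by
    rw [eval_X]
    refine (bitsToNat_lt _).trans_le (Nat.pow_le_pow_right (by norm_num) ?_)
    have a := length_fstF_sndF_le r
    change 2 * (fstP r).length + (sndP r).length ≤ _ at a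
    omega
  by_cases h1 : bitsToNat (sndP r) ≤ 1
  · simp only [if_pos h1, mul_zero, Nat.zero_mod]
    exact Nat.two_pow_pos _
  · exact (Nat.mod_lt _ (by omega)).trans hq

/-- For a modulus `q ≥ 2` the digit is `< q`. [folklore] -/
theorem digit_lt_modulus (ρ Pp C : List Bool → ℕ) (r : List Bool) (hq : 2 ≤ bitsToNat (sndP r)) :
    ((2 * ρ (boolPair (fstP (fstP r)) (sndP r)) + 1) * Pp (boolPair (boolPair (fstP (fstP r)) (sndP r)) (sndP r)) *
            (if bitsToNat (sndP r) ≤ 1 then 0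
              else 2 ^ (2 ^ (t.eval (fstP (fstP r)).length + 1) - 1 - bitsToNat (sndP (fstP r))) % bitsToNat (sndP r)) % bitsToNat (sndP r)) *
          (if bitsToNat (sndP r) ≤ 1 then 0
            else (2 * C (boolPair (boolPair (fstP (fstP r)) (sndP r)) (sndP r)) % bitsToNat (sndP r)) ^ (bitsToNat (sndP r) - 2) % bitsToNat (sndP r)) %
          bitsToNat (sndP r) < bitsToNat (sndP r) :=
  Nat.mod_lt _ (by omega)

/-- **Arithmetic meaning of the digits** (HAB 2002, Lemma 4.3 / Thm. 4.1): on `r = ⟨⟨w, bin s⟩, bin q⟩`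
with `q ≥ 2`, if `ρ ⟨w, bin q⟩ = X mod q`, `Pp ⟨⟨w, bin q⟩, bin q⟩ = P mod q` and
`C ⟨⟨w, bin q⟩, bin q⟩ = D mod q`, the digit is `((2X+1) 2^{N-1-s} P mod q) · ((2D) mod q)^{q-2} mod q)) mod q`,
`N = 2^{t|w|+1}` — the CRT digit `(Y_s mod q) · h_q mod q` of `Y_s = (2X+1) 2^{N-1-s} P` for the cofactor `2D`. [cite: HesseAllenderBarrington2002, Lemma 4.3] -/
theorem digit_eq (w : List Bool) (s q X P D : ℕ) (hq : 2 ≤ q) (hρ : ρ (boolPair w (encodeNat q)) = X % q)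
    (hPp : Pp (boolPair (boolPair w (encodeNat q)) (encodeNat q)) = P % q)
    (hC : C (boolPair (boolPair w (encodeNat q)) (encodeNat q)) = D % q) :
    ((2 * ρ (boolPair (fstP (fstP (boolPair (boolPair w (encodeNat s)) (encodeNat q)))) (sndP (boolPair (boolPair w (encodeNat s)) (encodeNat q)))) + 1) *
            Pp (boolPair (boolPair (fstP (fstP (boolPair (boolPair w (encodeNat s)) (encodeNat q)))) (sndP (boolPair (boolPair w (encodeNat s)) (encodeNat q))))
              (sndP (boolPair (boolPair w (encodeNat s)) (encodeNat q)))) *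
            (if bitsToNat (sndP (boolPair (boolPair w (encodeNat s)) (encodeNat q))) ≤ 1 then 0
              else 2 ^ (2 ^ (t.eval (fstP (fstP (boolPair (boolPair w (encodeNat s)) (encodeNat q)))).length + 1) - 1 -
                bitsToNat (sndP (fstP (boolPair (boolPair w (encodeNat s)) (encodeNat q))))) % bitsToNat (sndP (boolPair (boolPair w (encodeNat s)) (encodeNat q)))) %
          bitsToNat (sndP (boolPair (boolPair w (encodeNat s)) (encodeNat q)))) *
        (if bitsToNat (sndP (boolPair (boolPair w (encodeNat s)) (encodeNat q))) ≤ 1 then 0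
          else (2 * C (boolPair (boolPair (fstP (fstP (boolPair (boolPair w (encodeNat s)) (encodeNat q)))) (sndP (boolPair (boolPair w (encodeNat s)) (encodeNat q))))
            (sndP (boolPair (boolPair w (encodeNat s)) (encodeNat q)))) % bitsToNat (sndP (boolPair (boolPair w (encodeNat s)) (encodeNat q)))) ^
            (bitsToNat (sndP (boolPair (boolPair w (encodeNat s)) (encodeNat q))) - 2) % bitsToNat (sndP (boolPair (boolPair w (encodeNat s)) (encodeNat q)))) %
        bitsToNat (sndP (boolPair (boolPair w (encodeNat s)) (encodeNat q))) =
      ((2 * X + 1) * 2 ^ (2 ^ (t.eval w.length + 1) - 1 - s) * P % q) * ((2 * D % q) ^ (q - 2) % q) % q := by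
  simp only [fstP_boolPair, sndP_boolPair, bitsToNat_encodeNat]
  rw [if_neg (by omega), if_neg (by omega), hρ, hPp, hC]
  congr 1
  congr 1
  · have h : (2 * (X % q) + 1) * (P % q) * (2 ^ (2 ^ (t.eval w.length + 1) - 1 - s) % q) ≡
        (2 * X + 1) * P * 2 ^ (2 ^ (t.eval w.length + 1) - 1 - s) [MOD q] :=
      ((((Nat.mod_modEq X q).mul_left 2).add_right 1).mul (Nat.mod_modEq P q)).mul (Nat.mod_modEq _ q)
    rw [show (2 * X + 1) * 2 ^ (2 ^ (t.eval w.length + 1) - 1 - s) * P = (2 * X + 1) * P * 2 ^ (2 ^ (t.eval w.length + 1) - 1 - s) by ring]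
    exact h
  · rw [Nat.mul_mod 2 (D % q), Nat.mod_mod, ← Nat.mul_mod]

end Digits

end Literature.Computability.Complexity
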